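/- Fleet lead `ym-wcr-19456-p1` (seat g2), route `WeakCouplingRates`, crux `ColdBoxTwoPointFloorW` (stmt-QuantumFields-19608). -/
-- tree-module: Summits.QuantumFields.YangMills.Theorems.WeakCouplingRatesColdBoxDominationCore
import Summits.QuantumFields.YangMills.Theorems.WeakCouplingRatesColdBoxRepresentation
import Summits.QuantumFields.YangMills.Theorems.WeakCouplingRatesColdBoxCovBookkeeping
import Summits.QuantumFields.YangMills.Theorems.WeakCouplingRatesColdBoxGaussTail
import Summits.QuantumFields.YangMills.Theorems.WeakCouplingRatesColdBoxColourCov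

/-!
# Crux `ColdBoxTwoPointFloorW`, stub `stub_boxGaussianDomination`: the one-scale expansion ASSEMBLED at fixed `β` — a deterministic
# bound on `|β²·boxPlaqCov − ¾·boxDirCircSqCov|`

**`abs_boxPlaqCov_sub_dirCircSqCov_le_core`.**  For the `SU(2)` cold-wall box of half-side `H ≥ 1`, `β ≥ 1`, `T ≤ H`, small-field scale `ε`,
and real bookkeeping parameters `m, R, p` with
* `√2(12H²+2H+1)√(β^{2ε−1}) ≤ m ≤ ¼` (link bound, R1),
* `√3(12H²+2H+1)R/√(2β) ≤ ¼`, `3R²/(2β) + 362(√3(12H²+2H+1)R/√(2β))³ < β^{2ε−1}`, `0 ≤ R` (Gaussian window, R5),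
* `720(2H+1)⁴e^{−R²/2} ≤ p < 1`, `boxState(coldGoodSet) ≠ 0`,
* `|boxPlaqCov β H T − Cov_{boxState[|coldGoodSet]}(c_p, c_q)| ≤ c₀` (the large-field conditioning, p450121 for `H = ⌈β^θ⌉`),
one has, with `M = β^{2ε}`, `τ = 362βm³`, `w = #(plaquettesTouching Λ)·τ + 2·#(ColdFreeIdx H)·m²`:
`|β²·boxPlaqCov β H T − ¾·boxDirCircSqCov H T| ≤ β²c₀ + 3M²(e^{2w}−1) + 6M²p + 2τ(M+3) + √p·(6M + 33)`.
Chain: representation (`integral_cond_boxState_eq_integral_tilted`), tilt/conditioning/surrogate bookkeeping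
(`abs_cov_tilted_cond_sub_cov_le` with the bounds of `…TiltBound`, `…GaussTail`, `…GaussMoments`), and the colour identity
(`cov_qObs_gauss3_eq`).  No sorry; no new definition; standard axioms.  NOT a claim about the mass gap.
-/

set_option autoImplicit false

noncomputable section

open MeasureTheory ProbabilityTheory Finset Real
open Literature.Probability.LatticeModels (Site)
open Literature.MathematicalPhysics.QuantumLattice
open Literature.MathematicalPhysics.QuantumFieldTheory
open Literature.MathematicalPhysics.QuantumFieldTheory.LatticeMaxwell
open Literature.MathematicalPhysics.QuantumFieldTheory.AxialGauge

namespace Summit.QuantumFields.YangMills.Theorems.WeakCouplingRates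

variable {H : ℕ}

/-- `β·c_p` is gauge invariant. -/
theorem isZdGaugeInvariant_const_mul_plaqCostAt (β : ℝ) (x : Site 4) (i j : Fin 4) :
    IsZdGaugeInvariant (fun U : LGConfig 4 (Matrix.specialUnitaryGroup (Fin 2) ℂ) => β * plaqCostAt (fundamentalRep (Fin 2)) x i j U) :=
  fun g U => by simp only [plaqCostAt, isZdGaugeInvariant_plaquetteObs _ x i j g U]

/-- `(β·c_p)(β·c_q)` is gauge invariant. -/
theorem isZdGaugeInvariant_const_mul_plaqCostAt_mul (β : ℝ) (x y : Site 4) (i j k l : Fin 4) :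
    IsZdGaugeInvariant (fun U : LGConfig 4 (Matrix.specialUnitaryGroup (Fin 2) ℂ) =>
      β * plaqCostAt (fundamentalRep (Fin 2)) x i j U * (β * plaqCostAt (fundamentalRep (Fin 2)) y k l U)) :=
  fun g U => by simp only [plaqCostAt, isZdGaugeInvariant_plaquetteObs _ x i j g U, isZdGaugeInvariant_plaquetteObs _ y k l g U]

/-- The conditional covariance of the costs, rescaled: `β²·Cov(c_p,c_q) = Cov(β c_p, β c_q)`. -/
theorem sq_mul_cov_eq {Ω : Type*} [MeasurableSpace Ω] (μ : Measure Ω) (β : ℝ) (f g : Ω → ℝ) :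
    β ^ 2 * ((∫ ω, f ω * g ω ∂μ) - (∫ ω, f ω ∂μ) * (∫ ω, g ω ∂μ)) =
      (∫ ω, β * f ω * (β * g ω) ∂μ) - (∫ ω, β * f ω ∂μ) * (∫ ω, β * g ω ∂μ) := by
  have e1 : ∫ ω, β * f ω * (β * g ω) ∂μ = β ^ 2 * ∫ ω, f ω * g ω ∂μ := by
    rw [← integral_const_mul]; refine integral_congr_ae (ae_of_all _ fun ω => ?_); ring
  rw [e1, integral_const_mul, integral_const_mul]; ring

/-- **The one-scale expansion at fixed `β` (deterministic core).**  See the module docstring for the hypotheses; the conclusion is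
`|β²·boxPlaqCov β H T − ¾·boxDirCircSqCov H T| ≤ β²c₀ + 3M²(e^{2w}−1) + 6M²p + 2τ(M+3) + √p(6M+33)`. -/
theorem abs_boxPlaqCov_sub_dirCircSqCov_le_core {β ε m R p c₀ : ℝ} {T : ℕ} (hβ : 1 ≤ β) (hH : 1 ≤ H) (hT : T ≤ H)
    (hm : Real.sqrt 2 * ((12 * (H : ℝ) ^ 2 + 2 * H + 1) * Real.sqrt (β ^ (2 * ε - 1))) ≤ m) (hm4 : m ≤ 1 / 4)
    (hR : 0 ≤ R) (hmE : Real.sqrt 3 * (12 * (H : ℝ) ^ 2 + 2 * H + 1) * R / Real.sqrt (2 * β) ≤ 1 / 4)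
    (hwin : 3 * R ^ 2 / (2 * β) + 362 * (Real.sqrt 3 * (12 * (H : ℝ) ^ 2 + 2 * H + 1) * R / Real.sqrt (2 * β)) ^ 3 < β ^ (2 * ε - 1))
    (hp : 720 * (2 * (H : ℝ) + 1) ^ 4 * Real.exp (-R ^ 2 / 2) ≤ p) (hp1 : p < 1)
    (hG0 : boxState (fundamentalRep (Fin 2)) β H (coldGoodSet β ε H) ≠ 0)
    (hcond : |boxPlaqCov (fundamentalRep (Fin 2)) β H T -
        ((∫ U, plaqCostAt (fundamentalRep (Fin 2)) (boxCentre H) 1 2 U *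
              plaqCostAt (fundamentalRep (Fin 2)) (boxCentre H + Pi.single 0 (T : ℤ)) 1 2 U
            ∂((boxState (fundamentalRep (Fin 2)) β H)[|coldGoodSet β ε H])) -
          (∫ U, plaqCostAt (fundamentalRep (Fin 2)) (boxCentre H) 1 2 U ∂((boxState (fundamentalRep (Fin 2)) β H)[|coldGoodSet β ε H])) *
          (∫ U, plaqCostAt (fundamentalRep (Fin 2)) (boxCentre H + Pi.single 0 (T : ℤ)) 1 2 U
            ∂((boxState (fundamentalRep (Fin 2)) β H)[|coldGoodSet β ε H])))| ≤ c₀) :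
    |β ^ 2 * boxPlaqCov (fundamentalRep (Fin 2)) β H T - 3 / 4 * boxDirCircSqCov H T| ≤
      β ^ 2 * c₀ + 3 * (β ^ (2 * ε)) ^ 2 * (Real.exp (2 * ((#(plaquettesTouching (boxEdges 4 (2 * H + 1))) : ℝ) * (362 * β * m ^ 3) +
          2 * (Fintype.card (ColdFreeIdx H) : ℝ) * m ^ 2)) - 1) +
        6 * (β ^ (2 * ε)) ^ 2 * p + 2 * (362 * β * m ^ 3) * (β ^ (2 * ε) + 3) + Real.sqrt p * (2 * β ^ (2 * ε) * 3 + 24 + 3 ^ 2) := by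
  have hβ0 : 0 < β := by linarith
  -- abbreviations
  set ρ := fundamentalRep (Fin 2) with hρ
  set μ := boxState ρ β H with hμ
  set G := coldGoodSet β ε H with hG
  set γ := gauss3 H with hγ
  set S := goodT H β ε with hS
  set x₁ : Site 4 := boxCentre H with hx₁
  set x₂ : Site 4 := boxCentre H + Pi.single 0 (T : ℤ) with hx₂
  set f : LGConfig 4 (Matrix.specialUnitaryGroup (Fin 2) ℂ) → ℝ := fun U => β * plaqCostAt ρ x₁ 1 2 U with hf
  set g : LGConfig 4 (Matrix.specialUnitaryGroup (Fin 2) ℂ) → ℝ := fun U => β * plaqCostAt ρ x₂ 1 2 U with hg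
  set F : TSpace H → ℝ := fun t => β * plaqCostAt ρ x₁ 1 2 (cfgT H β t) with hF
  set Gt : TSpace H → ℝ := fun t => β * plaqCostAt ρ x₂ 1 2 (cfgT H β t) with hGt
  set Q₁ : TSpace H → ℝ := qObs H (plaq12At x₁) with hQ₁
  set Q₂ : TSpace H → ℝ := qObs H (plaq12At x₂) with hQ₂
  set m₀ : ℝ := Real.sqrt 2 * ((12 * (H : ℝ) ^ 2 + 2 * H + 1) * Real.sqrt (β ^ (2 * ε - 1))) with hm₀
  set τ : ℝ := 362 * β * m ^ 3 with hτ
  set w : ℝ := (#(plaquettesTouching (boxEdges 4 (2 * H + 1))) : ℝ) * τ + 2 * (Fintype.card (ColdFreeIdx H) : ℝ) * m ^ 2 with hw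
  set M : ℝ := β ^ (2 * ε) with hM
  set ν := (γ[|S]).tilted (S.indicator (tiltW H β)) with hν
  have hm₀0 : 0 ≤ m₀ := by positivity
  have hm0 : 0 ≤ m := hm₀0.trans hm
  have hm₀4 : m₀ ≤ 1 / 4 := hm.trans hm4
  have hτ0 : 0 ≤ τ := by positivity
  have hM0 : 0 ≤ M := by positivity
  -- the link-smallness window of the representation: `((12H²+2H+1)δ)² < 2` from `m₀ ≤ 1/4`
  have hη : ((12 * (H : ℝ) ^ 2 + 2 * H + 1) * Real.sqrt (β ^ (2 * ε - 1))) ^ 2 < 2 := by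
    have h2 : Real.sqrt 2 ^ 2 = 2 := Real.sq_sqrt (by norm_num)
    have h1 : m₀ ^ 2 ≤ (1 / 4) ^ 2 := pow_le_pow_left₀ hm₀0 hm₀4 2
    rw [hm₀, mul_pow, h2] at h1
    nlinarith
  -- the Gaussian mass of the bad event, and `γ S ≠ 0`
  have hpS : γ.real Sᶜ ≤ p := (gauss3_real_compl_goodT_le hβ0 hH hR hmE hwin).trans hp
  have hS0 : γ S ≠ 0 := by
    intro h0
    have h1 : γ.real S = 0 := by rw [measureReal_def, h0, ENNReal.toReal_zero]
    have h2 : γ.real S + γ.real Sᶜ = 1 := by rw [measureReal_add_measureReal_compl (measurableSet_goodT β ε), probReal_univ]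
    linarith
  -- step 1: the conditional covariance is the covariance under the tilted conditioned Gaussian
  have hrepF : ∫ U, f U ∂(μ[|G]) = ∫ t, F t ∂ν :=
    integral_cond_boxState_eq_integral_tilted hβ0 hH hη hG0 hS0 ((measurable_plaqCostAt _ _ _).const_mul β)
      (isZdGaugeInvariant_const_mul_plaqCostAt β x₁ 1 2) (fun U => mul_nonneg hβ0.le (plaqCostAt_nonneg _ _ _ _))
  have hrepG : ∫ U, g U ∂(μ[|G]) = ∫ t, Gt t ∂ν :=
    integral_cond_boxState_eq_integral_tilted hβ0 hH hη hG0 hS0 ((measurable_plaqCostAt _ _ _).const_mul β)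
      (isZdGaugeInvariant_const_mul_plaqCostAt β x₂ 1 2) (fun U => mul_nonneg hβ0.le (plaqCostAt_nonneg _ _ _ _))
  have hrepFG : ∫ U, f U * g U ∂(μ[|G]) = ∫ t, F t * Gt t ∂ν :=
    integral_cond_boxState_eq_integral_tilted hβ0 hH hη hG0 hS0
      (((measurable_plaqCostAt _ _ _).const_mul β).mul ((measurable_plaqCostAt _ _ _).const_mul β))
      (isZdGaugeInvariant_const_mul_plaqCostAt_mul β x₁ x₂ 1 2 1 2)
      (fun U => mul_nonneg (mul_nonneg hβ0.le (plaqCostAt_nonneg _ _ _ _)) (mul_nonneg hβ0.le (plaqCostAt_nonneg _ _ _ _)))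
  -- step 2: the bookkeeping
  have hPc := centre_mem_plaquettesTouching hH hT
  obtain ⟨hv1, hv2⟩ := integral_dirCirc_sq_le_one_centre hH hT
  obtain ⟨hQ₁L2, hQ₁K⟩ := memLp_two_qObs (H := H) (plaq12At x₁) hv1
  obtain ⟨hQ₂L2, hQ₂K⟩ := memLp_two_qObs (H := H) (plaq12At x₂) hv2
  obtain ⟨hQ₁₂L2, hQ₁₂K⟩ := memLp_two_qObs_mul_qObs (H := H) (plaq12At x₁) (plaq12At x₂) hv1 hv2
  have hWb : ∀ t, |S.indicator (tiltW H β) t| ≤ w := by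
    intro t
    by_cases ht : t ∈ S
    · rw [Set.indicator_of_mem ht]
      refine (abs_tiltW_le_of_mem_goodT hβ0 hH hm₀4 ht).trans ?_
      rw [hw, hτ]
      have h3 : m₀ ^ 3 ≤ m ^ 3 := pow_le_pow_left₀ hm₀0 hm 3
      have h2 : m₀ ^ 2 ≤ m ^ 2 := pow_le_pow_left₀ hm₀0 hm 2
      gcongr
    · rw [Set.indicator_of_notMem ht, abs_zero, hw]; positivity
  have hFb : ∀ t ∈ S, 0 ≤ F t ∧ F t ≤ M := fun t ht => by
    have h := beta_mul_plaqCostAt_mem_Icc_of_mem_goodT hβ0 ht hPc.1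
    exact h
  have hGb : ∀ t ∈ S, 0 ≤ Gt t ∧ Gt t ≤ M := fun t ht => by
    have h := beta_mul_plaqCostAt_mem_Icc_of_mem_goodT hβ0 ht hPc.2
    exact h
  have hFQ : ∀ t ∈ S, |F t - Q₁ t| ≤ τ := fun t ht => by
    have h := abs_beta_mul_plaqCostAt_sub_qObs_le_of_mem_goodT hβ0 hH hm₀4 ht x₁ 1 2
    refine h.trans ?_
    rw [hτ]
    have h3 : m₀ ^ 3 ≤ m ^ 3 := pow_le_pow_left₀ hm₀0 hm 3
    gcongr
  have hGQ : ∀ t ∈ S, |Gt t - Q₂ t| ≤ τ := fun t ht => by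
    have h := abs_beta_mul_plaqCostAt_sub_qObs_le_of_mem_goodT hβ0 hH hm₀4 ht x₂ 1 2
    refine h.trans ?_
    rw [hτ]
    have h3 : m₀ ^ 3 ≤ m ^ 3 := pow_le_pow_left₀ hm₀0 hm 3
    gcongr
  have hbook := abs_cov_tilted_cond_sub_cov_le (γ := γ) (measurableSet_goodT β ε) hS0 (measurable_tiltW β) hWb
    (((measurable_plaqCostAt _ _ _).const_mul β).comp (measurable_cfgT β))
    (((measurable_plaqCostAt _ _ _).const_mul β).comp (measurable_cfgT β))
    hQ₁L2 hQ₂L2 hQ₁₂L2 hM0 hτ0 (by norm_num : (0 : ℝ) ≤ 3) (by norm_num : (0 : ℝ) ≤ 24) hFb hGb hFQ hGQ hpS hQ₁K hQ₂K hQ₁₂K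
  -- step 3: the colour identity
  have hcol : (∫ t, Q₁ t * Q₂ t ∂γ) - (∫ t, Q₁ t ∂γ) * (∫ t, Q₂ t ∂γ) = 3 / 4 * boxDirCircSqCov H T := cov_qObs_gauss3_eq hH hT
  -- assemble
  have hcov : β ^ 2 * boxPlaqCov ρ β H T - 3 / 4 * boxDirCircSqCov H T =
      β ^ 2 * (boxPlaqCov ρ β H T -
        ((∫ U, plaqCostAt ρ x₁ 1 2 U * plaqCostAt ρ x₂ 1 2 U ∂(μ[|G])) -
          (∫ U, plaqCostAt ρ x₁ 1 2 U ∂(μ[|G])) * (∫ U, plaqCostAt ρ x₂ 1 2 U ∂(μ[|G])))) +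
      ((((∫ t, F t * Gt t ∂ν) - (∫ t, F t ∂ν) * (∫ t, Gt t ∂ν)) -
          ((∫ t, Q₁ t * Q₂ t ∂γ) - (∫ t, Q₁ t ∂γ) * (∫ t, Q₂ t ∂γ)))) := by
    rw [hcol, ← hrepF, ← hrepG, ← hrepFG, ← sq_mul_cov_eq]
    ring
  have h1 : |β ^ 2 * (boxPlaqCov ρ β H T -
        ((∫ U, plaqCostAt ρ x₁ 1 2 U * plaqCostAt ρ x₂ 1 2 U ∂(μ[|G])) -
          (∫ U, plaqCostAt ρ x₁ 1 2 U ∂(μ[|G])) * (∫ U, plaqCostAt ρ x₂ 1 2 U ∂(μ[|G]))))| ≤ β ^ 2 * c₀ := by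
    rw [abs_mul, abs_of_nonneg (by positivity : (0 : ℝ) ≤ β ^ 2)]
    exact mul_le_mul_of_nonneg_left hcond (by positivity)
  rw [hcov]
  refine (abs_add_le _ _).trans ((add_le_add h1 hbook).trans (le_of_eq ?_))
  ring

end Summit.QuantumFields.YangMills.Theorems.WeakCouplingRates

end
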